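import Mathlib
import Summits.Parity.GeneralizedHardyLittlewood.Theorems.FordMaynardSieveConst01651SieveConst01651TypeIIBilin
import Summits.Parity.GeneralizedHardyLittlewood.Theorems.FordMaynardSieveConst01651SieveConst01651BilinTools
import Summits.Parity.GeneralizedHardyLittlewood.Theorems.FordMaynardSieveConst01651SieveConst01651BilinMass

/-!
# Route `FordMaynardSieveConst01651`, target `SieveConst01651` (stmt-Parity-19185), line `sieve_decomposition`:
# helpers towards `stub_typeIIRegion` — discarding an exceptional set through (II): the pipeline assembled

End-to-end use of the toolkit landed for the Prop 7.19 programme (Ford–Maynard, arXiv:2407.14368v1, §7):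
`(II)` ⟹ `BilinBoundedBy` (`bilinBoundedBy_of_typeII_zero`, …TypeIIBilin) ⟹ separate the coupling
`q ≤ P⁻(n'')` (an integer threshold, Lemma 7.9: `bilin_threshold_nat_le'`, …BilinTools) and absorb a one-variable
condition `Q(n'')` (`bilin_indicator_twist`) ⟹ `|w|`-mass via the second half of (w) (`bilin_abs_mass_le`,
…BilinMass).  Result (`typeII_abs_mass_minFac_le`): for `w ≥ −M` satisfying (II) on `((x/2)^θ, x^{θ+ν}]` with
exponent `B ≥ 0` and ANY decidable condition `Q` on the cofactor,
`∑_{(x/2)^θ < q ≤ x^{θ+ν}} ∑_{n'' ≤ x : x/2 < q n'' ≤ x, q ≤ P⁻(n''), Q(n'')} |w(q n'')|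
   ≤ 3(1 + log(2N + 4)) · x/(log x)^B + 2M · #{such pairs}`, `N = ⌊x^{θ+ν}⌋ + ⌊x⌋`.
At `P = (1/2, 0, ν)` (`θ = 0`), with `q = P⁻(n)` the least prime factor of a non-rough `n = q n''` and
`Q(n'') = [∃ p > (x/2)^ν prime, p² ∣ n'']`, this removes the members of `W ∖ (𝒫 ∪ 𝒩)` whose rough part is not
squarefree (count `≪ x^{1−ν} log log x` by …SquareDivisorCount, `M = x^{ν/10}` by (w)) — the patch needed before the
printed `J ⊆ [k]` indexing of `H(n)` (…HwtSubsets) applies.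
Def-free. Nothing here proves anything about the Parity summit.
-/

open Finset Literature.NumberTheory.Sieve.FriedlanderIwaniecPrimes

namespace Summit.Parity.GeneralizedHardyLittlewood.FordMaynardSieveConst01651SieveConst01651

/-- **Exceptional sets through (II), assembled**: see the module docstring.
[cite: FordMaynard2024PrimeSieves, §1 (II), Lemma 7.9, Lemma 7.10 (use of (w))] -/
theorem typeII_abs_mass_minFac_le {w : ℕ → ℝ} {x θ ν B M : ℝ}
    (hII : Literature.Barriers.Parity.FordMaynard.TypeII w x θ ν B) (hB : 0 ≤ B) (hM : 0 ≤ M)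
    (hw : ∀ n, -M ≤ w n) (Q : ℕ → Prop) [DecidablePred Q] :
    ∑ q ∈ (Icc 1 ⌊x ^ (θ + ν)⌋₊).filter (fun m : ℕ => (x / 2) ^ θ < (m : ℝ)),
      ∑ n ∈ (Icc 1 ⌊x⌋₊).filter (fun n : ℕ =>
          (x / 2 < (q * n : ℝ) ∧ (q * n : ℝ) ≤ x) ∧ q ≤ Nat.minFac n ∧ Q n), |w (q * n)| ≤
      3 * (1 + Real.log (2 * ((⌊x ^ (θ + ν)⌋₊ + ⌊x⌋₊ + 1 : ℕ) : ℝ) + 2)) * (x / Real.log x ^ B) +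
      2 * M * ((((Icc 1 ⌊x ^ (θ + ν)⌋₊).filter (fun m : ℕ => (x / 2) ^ θ < (m : ℝ)) ×ˢ Icc 1 ⌊x⌋₊).filter
        (fun p : ℕ × ℕ => (x / 2 < (p.1 * p.2 : ℝ) ∧ (p.1 * p.2 : ℝ) ≤ x) ∧ p.1 ≤ Nat.minFac p.2 ∧ Q p.2)).card
          : ℝ) := by
  set W : Finset ℕ := (Icc 1 ⌊x ^ (θ + ν)⌋₊).filter (fun m : ℕ => (x / 2) ^ θ < (m : ℝ)) with hW
  set Z : Finset ℕ := Icc 1 ⌊x⌋₊ with hZ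
  set N : ℕ := ⌊x ^ (θ + ν)⌋₊ + ⌊x⌋₊ with hN
  -- (II) as a bilinear bound, then the integer threshold `q ≤ P⁻(n'')`, then the free condition `Q(n'')`
  have h0 := bilinBoundedBy_of_typeII_zero hII hB
  have hf : ∀ q ∈ W, (fun q : ℕ => q) q ≤ N := by
    intro q hq
    have := (Finset.mem_Icc.mp (Finset.mem_filter.mp hq).1).2
    simp only [hN]; omega
  have hg : ∀ n ∈ Z, (fun n : ℕ => Nat.minFac n) n ≤ N := by
    intro n hn
    obtain ⟨h1, h2⟩ := Finset.mem_Icc.mp hn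
    have := Nat.minFac_le (by omega : 0 < n)
    simp only [hN]; omega
  have h1 := bilin_threshold_nat_le' h0 (fun q : ℕ => q) (fun n : ℕ => Nat.minFac n) hf hg
  have h2 := bilin_indicator_twist h1 (fun _ : ℕ => True) Q
  -- rewrite the kernel as `𝟙[E] · w(q n'')`
  have h3 : BilinBoundedBy (fun q n : ℕ => (if ((x / 2 < (q * n : ℝ) ∧ (q * n : ℝ) ≤ x) ∧
        q ≤ Nat.minFac n ∧ Q n) then (1 : ℂ) else 0) * (w (q * n) : ℂ)) W Z
      (3 * (1 + Real.log (2 * ((N + 1 : ℕ) : ℝ) + 2)) * (x / Real.log x ^ B)) := by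
    refine h2.congr fun q _ n _ => ?_
    by_cases hA : x / 2 < (q * n : ℝ) ∧ (q * n : ℝ) ≤ x <;> by_cases hB' : q ≤ Nat.minFac n <;>
      by_cases hC : Q n <;> simp [hA, hB', hC]
  -- the `|w|`-mass
  have h4 := bilin_abs_mass_le (W := W) (Z := Z)
    (fun q n : ℕ => (x / 2 < (q * n : ℝ) ∧ (q * n : ℝ) ≤ x) ∧ q ≤ Nat.minFac n ∧ Q n) hM hw h3
  exact h4

end Summit.Parity.GeneralizedHardyLittlewood.FordMaynardSieveConst01651SieveConst01651
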